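/-
Copyright (c) 2026 the pub-hodgecm-mathlib formalisation cell (harness21).  Prover seat hodgecm-mathlib-K2Liu-p12 (g6), Track B «K2-LIT»,
#184♮ = hLiu418 = `stmt-HodgeConjecture-24832`; #42S block D, row D-2, (σ-A) mini-road (LEAD F0P6-plan (g15) RULING M-160f + BATCH #227),
brick [A2] «PARTIAL FOURIER + PRODUCT SPLITTING», FILE 1∕2 (coordinates, Fubini, slices, pure tensors).  THEOREMS ONLY (no `def`, no `instance`,
no `notation`, no named-fact hypothesis, no `sorry`).
-/
import Literature.NumberTheory.Automorphic.LocalSchwartzBruhatDirectSum     -- ★ `glue∕resL∕resR`, `boxSB`, `sumEquivSB`, `sumEndSB`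
import Literature.RepresentationTheory.HeisenbergGroup.SchrodingerWeylElement -- ★ `integrable_of_mem_schwartzBruhat`
import Literature.NumberTheory.Automorphic.TateLocalZetaShells              -- ★ `secondCountableTopology_localField`
import Mathlib.MeasureTheory.Constructions.Pi
import Mathlib.MeasureTheory.Integral.Prod
import Mathlib.LinearAlgebra.TensorProduct.Finiteness
import HarnessLib

/-!
# Crux `HLiu418`, socket #42S block D (row D-2, (σ-A) mini-road), brick [A2] FILE 1∕2 `K2LiuLocalPiGlueFubini`:
# GLUED COORDINATES `a ⊔ b` ON `F^ι = F^{ι₁} × F^{ι₂}` — THE PAIRING SPLITS, THE PRODUCT HAAR MEASURE REGROUPS (FUBINI), SLICES AND PURE TENSORS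

Cell `hodgecm-mathlib`, crux item hLiu418 = `stmt-HodgeConjecture-24832`; squad K2 ∕ K2Liu, road `K2_Liu`, socket #42S; LEAD F0P6-plan (g15)
RULING M-160f + BATCH #227 ([A2] → K2Liu-p12; (σ-A) road desk K2Liu-p25 (g3)).  Lane `--supports stmt-HodgeConjecture-24832 --as helper`
(count-neutral helper; closes no socket by itself).  FILE 2∕2 `K2LiuLocalPiPartialFourierSplitting` (the partial Fourier integrals and the
splitting `𝓕_ι = 𝓕_{ι₁} ⊠ 𝓕_{ι₂}`) imports this file.

SETTING.  `e : ι₁ ⊕ ι₂ ≃ ι` a splitting of finitely many coordinates (instances of record, named by [A1]: `Fin 6 ⊕ Fin 6 ≃ Fin 12` for the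
`e₁ ⊗ V′ ∕ e₂ ⊗ V′` blocks and `Fin 4 ⊕ Fin 8 ≃ Fin 12` for `X ⊗ V₁ ∕ X ⊗ H` in the Schrödinger model `𝒮(L⁺_v^{12})`; everything here is GENERIC
in `e`), the tree's coordinates `glue e a b = a ⊔ b`, `resL e v = v|ι₁`, `resR e v = v|ι₂` and the exact decomposition ★ `sumEquivSB F e :
𝒮(F^{ι₁}) ⊗ 𝒮(F^{ι₂}) ≃ₗ 𝒮(F^ι)`, `boxSB F e f₁ f₂ = f₁ ⊠ f₂` (★ `LocalSchwartzBruhatDirectSum`).  CONTENT: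
* §1 `dotProduct_glue` — `(a ⊔ b) ⬝ᵥ (a′ ⊔ b′) = a ⬝ᵥ a′ + b ⬝ᵥ b′`; `glue_smul`, `glue_neg`, `glue_sub`;
* §2 REGROUPING of the product measures `μ^ι := Measure.pi fun _ => μ` (Rao's `fourierOpPi μ` currency; `μ` σ-finite on `F`): `(a, b) ↦ a ⊔ b` is
  Mathlib's `sumPiEquivProdPi⁻¹ ≫ piCongrLeft e`, MEASURE PRESERVING `μ^{ι₁} × μ^{ι₂} → μ^ι` (`measurePreserving_glue`; ungluing
  `measurePreserving_resL_resR` — the public form of the private lemma of ★ `SchwartzBruhatL2NormDirectSum`), `integral_comp_glue`,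
  `integrable_comp_glue_iff`, FUBINI **`integral_pi_eq_integral_integral_glue : ∫ f dμ^ι = ∫_a ∫_b f(a ⊔ b) dμ^{ι₂} dμ^{ι₁}`** (+ `ι₂`-outer twin),
  and the hypothesis-free Schwartz–Bruhat instances over a non-archimedean local field with a Haar `μ`;
* §3 SLICES `u ↦ Θ(u ⊔ b)`, `w ↦ Θ(a ⊔ w)` of `Θ ∈ 𝒮(F^ι)` are Schwartz–Bruhat;
* §4 PURE-TENSOR TOOLS for [A4]: `boxSB_induction_on` (`0` ∕ `f₁ ⊠ f₂` ∕ `+`), `exists_finset_eq_sum_boxSB` (every `Θ ∈ 𝒮(F^ι)` is a finite sum of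
  products), `exists_finset_coe_eq_sum_mul`.
[cite: WeilBNT1967, Chap. VII §2, Prop. 2] [cite: Kudla1984, §1] [cite: MoeglinVignerasWaldspurger1987, Chap. 2 II.1 Rem. (6)]
HONEST LABEL.  Count-neutral helper; it retires nothing by itself: `HC_CM` is proved only modulo the 7 printed citations (2 remaining named inputs:
hLiu418 = `stmt-HodgeConjecture-24832`, h413 = `stmt-HodgeConjecture-24833`) until rung 0 closes.

## References
* [WeilBNT1967] A. Weil, *Basic Number Theory* (1967), Chap. VII §2, Prop. 2 (standard functions on a product of `p`-fields; Fubini for them).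
* [Kudla1984] S. Kudla, *Seesaw dual reductive pairs*, Progr. Math. 46 (1984), §1 (coordinates of `W₁ ⊕ W₂`).
* [MoeglinVignerasWaldspurger1987] C. Mœglin, M.-F. Vignéras, J.-L. Waldspurger, LNM 1291 (1987), Chap. 2 II.1 Rem. (6) (`S = S₁ ⊗ S₂`).
-/

set_option autoImplicit false
set_option linter.dupNamespace false -- the mandated namespace repeats `HodgeConjecture.HodgeConjecture`

noncomputable section

open MeasureTheory
open scoped Matrix TensorProduct
open Literature.NumberTheory.Automorphic
open Literature.NumberTheory.GaloisRepresentations.IsNonarchimedeanLocalField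
open Literature.RepresentationTheory.HeisenbergGroup

namespace Summit.HodgeConjecture.HodgeConjecture.Cruxes.HLiu418.K2LiuLocalPiGlueFubini

/-! ## §1 Glued vectors: scalars, negation, and the splitting of the standard pairing -/

section GlueAlgebra

variable {R : Type*} {ι₁ ι₂ ι : Type*} (e : ι₁ ⊕ ι₂ ≃ ι)

/-- `(c • a) ⊔ (c • b) = c • (a ⊔ b)`. [cite: Kudla1984, §1] -/
theorem glue_smul {S : Type*} [SMul S R] (c : S) (a : ι₁ → R) (b : ι₂ → R) : glue e (c • a) (c • b) = c • glue e a b := by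
  funext k
  obtain ⟨s, rfl⟩ := e.surjective k
  rcases s with i | j
  · rw [glue_apply_inl, Pi.smul_apply, Pi.smul_apply, glue_apply_inl]
  · rw [glue_apply_inr, Pi.smul_apply, Pi.smul_apply, glue_apply_inr]

/-- `(-a) ⊔ (-b) = -(a ⊔ b)`. [cite: Kudla1984, §1] -/
theorem glue_neg [Neg R] (a : ι₁ → R) (b : ι₂ → R) : glue e (-a) (-b) = -glue e a b := by
  funext k
  obtain ⟨s, rfl⟩ := e.surjective k
  rcases s with i | j
  · rw [glue_apply_inl, Pi.neg_apply, Pi.neg_apply, glue_apply_inl]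
  · rw [glue_apply_inr, Pi.neg_apply, Pi.neg_apply, glue_apply_inr]

/-- `(a ⊔ b) - (a′ ⊔ b′) = (a - a′) ⊔ (b - b′)`. [cite: Kudla1984, §1] -/
theorem glue_sub [AddGroup R] (a a' : ι₁ → R) (b b' : ι₂ → R) : glue e a b - glue e a' b' = glue e (a - a') (b - b') := by
  rw [sub_eq_add_neg, ← glue_neg, glue_add, ← sub_eq_add_neg, ← sub_eq_add_neg]

variable [Fintype ι₁] [Fintype ι₂] [Fintype ι]

/-- **the standard pairing splits along `e`**: `(a ⊔ b) ⬝ᵥ (a′ ⊔ b′) = a ⬝ᵥ a′ + b ⬝ᵥ b′` (re-index the sum over `ι` along `e` and split it over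
`ι₁ ⊕ ι₂`). [cite: WeilBNT1967, Chap. VII §2, Prop. 2] -/
theorem dotProduct_glue [Mul R] [AddCommMonoid R] (a a' : ι₁ → R) (b b' : ι₂ → R) :
    glue e a b ⬝ᵥ glue e a' b' = a ⬝ᵥ a' + b ⬝ᵥ b' := by
  unfold dotProduct
  rw [← Equiv.sum_comp e, Fintype.sum_sum_type]
  simp only [glue_apply_inl, glue_apply_inr]

/-- the pairing against `a′ ⊔ 0` only sees the first block. [cite: WeilBNT1967, Chap. VII §2, Prop. 2] -/
theorem dotProduct_glue_zero_right [NonUnitalNonAssocSemiring R] (a a' : ι₁ → R) (b : ι₂ → R) :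
    glue e a b ⬝ᵥ glue e a' 0 = a ⬝ᵥ a' := by
  rw [dotProduct_glue, dotProduct_zero, add_zero]

/-- the pairing against `0 ⊔ b′` only sees the second block. [cite: WeilBNT1967, Chap. VII §2, Prop. 2] -/
theorem dotProduct_glue_zero_left [NonUnitalNonAssocSemiring R] (a : ι₁ → R) (b b' : ι₂ → R) :
    glue e a b ⬝ᵥ glue e 0 b' = b ⬝ᵥ b' := by
  rw [dotProduct_glue, dotProduct_zero, zero_add]

end GlueAlgebra

/-! ## §2 Regrouping the product measure along `e`; Fubini -/

section Regroup

variable (F : Type*) [MeasurableSpace F] {ι₁ ι₂ ι : Type*} (e : ι₁ ⊕ ι₂ ≃ ι)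

/-- the ungluing `v ↦ (v|ι₁, v|ι₂)` is Mathlib's measurable equivalence `sumPiEquivProdPi ∘ (piCongrLeft e)⁻¹`. [cite: Kudla1984, §1] -/
theorem resL_resR_eq_measurableEquiv (v : ι → F) :
    (resL e v, resR e v) =
      (MeasurableEquiv.sumPiEquivProdPi fun _ : ι₁ ⊕ ι₂ => F) ((MeasurableEquiv.piCongrLeft (fun _ : ι => F) e).symm v) := by
  refine Prod.ext (funext fun i => ?_) (funext fun j => ?_)
  · change v (e (Sum.inl i)) = (Equiv.piCongrLeft (fun _ : ι => F) e).symm v (Sum.inl i)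
    rw [Equiv.piCongrLeft_symm_apply]
  · change v (e (Sum.inr j)) = (Equiv.piCongrLeft (fun _ : ι => F) e).symm v (Sum.inr j)
    rw [Equiv.piCongrLeft_symm_apply]

/-- the gluing `(a, b) ↦ a ⊔ b` is Mathlib's measurable equivalence `(piCongrLeft e) ∘ sumPiEquivProdPi⁻¹`. [cite: Kudla1984, §1] -/
theorem glue_eq_measurableEquiv (p : (ι₁ → F) × (ι₂ → F)) :
    glue e p.1 p.2 =
      (MeasurableEquiv.piCongrLeft (fun _ : ι => F) e) ((MeasurableEquiv.sumPiEquivProdPi fun _ : ι₁ ⊕ ι₂ => F).symm p) := by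
  funext k
  obtain ⟨s, rfl⟩ := e.surjective k
  rw [MeasurableEquiv.coe_piCongrLeft, Equiv.piCongrLeft_apply_apply]
  rcases s with i | j
  · rw [glue_apply_inl]; rfl
  · rw [glue_apply_inr]; rfl

/-- the ungluing is a measurable embedding. [cite: WeilBNT1967, Chap. VII §2, Prop. 2] -/
theorem measurableEmbedding_resL_resR : MeasurableEmbedding fun v : ι → F => (resL e v, resR e v) := by
  have hfun : (fun v : ι → F => (resL e v, resR e v)) =
      ((MeasurableEquiv.piCongrLeft (fun _ : ι => F) e).symm.trans (MeasurableEquiv.sumPiEquivProdPi fun _ : ι₁ ⊕ ι₂ => F)) :=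
    funext fun v => resL_resR_eq_measurableEquiv F e v
  rw [hfun]
  exact MeasurableEquiv.measurableEmbedding _

/-- the gluing is a measurable embedding. [cite: WeilBNT1967, Chap. VII §2, Prop. 2] -/
theorem measurableEmbedding_glue : MeasurableEmbedding fun p : (ι₁ → F) × (ι₂ → F) => glue e p.1 p.2 := by
  have hfun : (fun p : (ι₁ → F) × (ι₂ → F) => glue e p.1 p.2) =
      ((MeasurableEquiv.sumPiEquivProdPi fun _ : ι₁ ⊕ ι₂ => F).symm.trans (MeasurableEquiv.piCongrLeft (fun _ : ι => F) e)) :=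
    funext fun p => glue_eq_measurableEquiv F e p
  rw [hfun]
  exact MeasurableEquiv.measurableEmbedding _

variable [Fintype ι₁] [Fintype ι₂] [Fintype ι] (μ : Measure F) [SigmaFinite μ]

/-- **the ungluing `v ↦ (v|ι₁, v|ι₂)` carries `μ^ι` to `μ^{ι₁} × μ^{ι₂}`**. [cite: WeilBNT1967, Chap. VII §2, Prop. 2] -/
theorem measurePreserving_resL_resR :
    MeasurePreserving (fun v : ι → F => (resL e v, resR e v)) (Measure.pi fun _ : ι => μ)
      ((Measure.pi fun _ : ι₁ => μ).prod (Measure.pi fun _ : ι₂ => μ)) := by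
  have h1 : MeasurePreserving (MeasurableEquiv.piCongrLeft (fun _ : ι => F) e).symm (Measure.pi fun _ : ι => μ)
      (Measure.pi fun _ : ι₁ ⊕ ι₂ => μ) :=
    (measurePreserving_piCongrLeft (fun _ : ι => μ) e).symm _
  have h2 : MeasurePreserving (MeasurableEquiv.sumPiEquivProdPi fun _ : ι₁ ⊕ ι₂ => F)
      (Measure.pi fun _ : ι₁ ⊕ ι₂ => μ) ((Measure.pi fun _ : ι₁ => μ).prod (Measure.pi fun _ : ι₂ => μ)) :=
    measurePreserving_sumPiEquivProdPi fun _ : ι₁ ⊕ ι₂ => μ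
  have hfun : (fun v : ι → F => (resL e v, resR e v)) =
      (MeasurableEquiv.sumPiEquivProdPi fun _ : ι₁ ⊕ ι₂ => F) ∘ (MeasurableEquiv.piCongrLeft (fun _ : ι => F) e).symm :=
    funext fun v => resL_resR_eq_measurableEquiv F e v
  rw [hfun]
  exact h2.comp h1

/-- **the gluing `(a, b) ↦ a ⊔ b` carries `μ^{ι₁} × μ^{ι₂}` to `μ^ι`**. [cite: WeilBNT1967, Chap. VII §2, Prop. 2] -/
theorem measurePreserving_glue :
    MeasurePreserving (fun p : (ι₁ → F) × (ι₂ → F) => glue e p.1 p.2)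
      ((Measure.pi fun _ : ι₁ => μ).prod (Measure.pi fun _ : ι₂ => μ)) (Measure.pi fun _ : ι => μ) := by
  have h1 : MeasurePreserving (MeasurableEquiv.sumPiEquivProdPi fun _ : ι₁ ⊕ ι₂ => F).symm
      ((Measure.pi fun _ : ι₁ => μ).prod (Measure.pi fun _ : ι₂ => μ)) (Measure.pi fun _ : ι₁ ⊕ ι₂ => μ) :=
    measurePreserving_sumPiEquivProdPi_symm fun _ : ι₁ ⊕ ι₂ => μ
  have h2 : MeasurePreserving (MeasurableEquiv.piCongrLeft (fun _ : ι => F) e) (Measure.pi fun _ : ι₁ ⊕ ι₂ => μ)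
      (Measure.pi fun _ : ι => μ) :=
    measurePreserving_piCongrLeft (fun _ : ι => μ) e
  have hfun : (fun p : (ι₁ → F) × (ι₂ → F) => glue e p.1 p.2) =
      (MeasurableEquiv.piCongrLeft (fun _ : ι => F) e) ∘ (MeasurableEquiv.sumPiEquivProdPi fun _ : ι₁ ⊕ ι₂ => F).symm :=
    funext fun p => glue_eq_measurableEquiv F e p
  rw [hfun]
  exact h2.comp h1

/-- **change of variables along the gluing**: `∫ f(a ⊔ b) d(μ^{ι₁} × μ^{ι₂})(a, b) = ∫ f dμ^ι`. [cite: WeilBNT1967, Chap. VII §2, Prop. 2] -/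
theorem integral_comp_glue {E : Type*} [NormedAddCommGroup E] [NormedSpace ℝ E] (f : (ι → F) → E) :
    ∫ p, f (glue e p.1 p.2) ∂((Measure.pi fun _ : ι₁ => μ).prod (Measure.pi fun _ : ι₂ => μ)) = ∫ v, f v ∂(Measure.pi fun _ : ι => μ) :=
  (measurePreserving_glue F e μ).integral_comp (measurableEmbedding_glue F e) f

/-- integrability transfers along the gluing. [cite: WeilBNT1967, Chap. VII §2, Prop. 2] -/
theorem integrable_comp_glue_iff {E : Type*} [NormedAddCommGroup E] (f : (ι → F) → E) :
    Integrable (fun p : (ι₁ → F) × (ι₂ → F) => f (glue e p.1 p.2)) ((Measure.pi fun _ : ι₁ => μ).prod (Measure.pi fun _ : ι₂ => μ)) ↔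
      Integrable f (Measure.pi fun _ : ι => μ) :=
  (measurePreserving_glue F e μ).integrable_comp_emb (measurableEmbedding_glue F e)

/-- **FUBINI ALONG A COORDINATE SPLITTING** (`ι₁`-variables outside): for `f` integrable on `F^ι`,
`∫ f dμ^ι = ∫_a ∫_b f(a ⊔ b) dμ^{ι₂}(b) dμ^{ι₁}(a)`. [cite: WeilBNT1967, Chap. VII §2, Prop. 2] -/
theorem integral_pi_eq_integral_integral_glue {E : Type*} [NormedAddCommGroup E] [NormedSpace ℝ E] {f : (ι → F) → E}
    (hf : Integrable f (Measure.pi fun _ : ι => μ)) :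
    ∫ v, f v ∂(Measure.pi fun _ : ι => μ) =
      ∫ a, ∫ b, f (glue e a b) ∂(Measure.pi fun _ : ι₂ => μ) ∂(Measure.pi fun _ : ι₁ => μ) := by
  rw [← integral_comp_glue F e μ f]
  exact integral_prod (fun p : (ι₁ → F) × (ι₂ → F) => f (glue e p.1 p.2)) ((integrable_comp_glue_iff F e μ f).2 hf)

/-- **FUBINI ALONG A COORDINATE SPLITTING** (`ι₂`-variables outside): `∫ f dμ^ι = ∫_b ∫_a f(a ⊔ b) dμ^{ι₁}(a) dμ^{ι₂}(b)`.
[cite: WeilBNT1967, Chap. VII §2, Prop. 2] -/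
theorem integral_pi_eq_integral_integral_glue_symm {E : Type*} [NormedAddCommGroup E] [NormedSpace ℝ E] {f : (ι → F) → E}
    (hf : Integrable f (Measure.pi fun _ : ι => μ)) :
    ∫ v, f v ∂(Measure.pi fun _ : ι => μ) =
      ∫ b, ∫ a, f (glue e a b) ∂(Measure.pi fun _ : ι₁ => μ) ∂(Measure.pi fun _ : ι₂ => μ) := by
  rw [← integral_comp_glue F e μ f]
  exact integral_prod_symm (fun p : (ι₁ → F) × (ι₂ → F) => f (glue e p.1 p.2)) ((integrable_comp_glue_iff F e μ f).2 hf)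

end Regroup

section RegroupLocalField

variable (F : Type*) [Field F] [ValuativeRel F] [TopologicalSpace F] [IsNonarchimedeanLocalField F] [MeasurableSpace F] [BorelSpace F]
  {ι₁ ι₂ ι : Type*} [Fintype ι₁] [Fintype ι₂] [Fintype ι] (e : ι₁ ⊕ ι₂ ≃ ι) (μ : Measure F) [μ.IsAddHaarMeasure]

/-- **FUBINI FOR A SCHWARTZ–BRUHAT INTEGRAND over a non-archimedean local field** (no integrability hypothesis: `Θ` is integrable for the Haar
measure `μ^ι`): `∫ Θ dμ^ι = ∫_a ∫_b Θ(a ⊔ b) dμ^{ι₂} dμ^{ι₁}`. [cite: WeilBNT1967, Chap. VII §2, Prop. 2] -/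
theorem integral_pi_schwartzBruhat_eq_integral_integral_glue {Θ : (ι → F) → ℂ} (hΘ : Θ ∈ SchwartzBruhat (ι → F)) :
    ∫ v, Θ v ∂(Measure.pi fun _ : ι => μ) = ∫ a, ∫ b, Θ (glue e a b) ∂(Measure.pi fun _ : ι₂ => μ) ∂(Measure.pi fun _ : ι₁ => μ) := by
  haveI : SecondCountableTopology F := secondCountableTopology_localField F
  exact integral_pi_eq_integral_integral_glue F e μ (integrable_of_mem_schwartzBruhat (Measure.pi fun _ : ι => μ) hΘ)

/-- the `ι₂`-outer twin: `∫ Θ dμ^ι = ∫_b ∫_a Θ(a ⊔ b) dμ^{ι₁} dμ^{ι₂}`. [cite: WeilBNT1967, Chap. VII §2, Prop. 2] -/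
theorem integral_pi_schwartzBruhat_eq_integral_integral_glue_symm {Θ : (ι → F) → ℂ} (hΘ : Θ ∈ SchwartzBruhat (ι → F)) :
    ∫ v, Θ v ∂(Measure.pi fun _ : ι => μ) = ∫ b, ∫ a, Θ (glue e a b) ∂(Measure.pi fun _ : ι₁ => μ) ∂(Measure.pi fun _ : ι₂ => μ) := by
  haveI : SecondCountableTopology F := secondCountableTopology_localField F
  exact integral_pi_eq_integral_integral_glue_symm F e μ (integrable_of_mem_schwartzBruhat (Measure.pi fun _ : ι => μ) hΘ)

omit [BorelSpace F] in
/-- change of variables for a Haar `μ` (σ-finiteness discharged): `∫ f(a ⊔ b) d(μ^{ι₁} × μ^{ι₂}) = ∫ f dμ^ι`. [cite: WeilBNT1967, Chap. VII §2, Prop. 2] -/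
theorem integral_comp_glue_haar {E : Type*} [NormedAddCommGroup E] [NormedSpace ℝ E] (f : (ι → F) → E) :
    ∫ p, f (glue e p.1 p.2) ∂((Measure.pi fun _ : ι₁ => μ).prod (Measure.pi fun _ : ι₂ => μ)) = ∫ v, f v ∂(Measure.pi fun _ : ι => μ) := by
  haveI : SecondCountableTopology F := secondCountableTopology_localField F
  exact integral_comp_glue F e μ f

end RegroupLocalField

/-! ## §3 Slices of a Schwartz–Bruhat function along `e` -/

section Slices

variable {F : Type*} [TopologicalSpace F] {ι₁ ι₂ ι : Type*} (e : ι₁ ⊕ ι₂ ≃ ι)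

/-- **the `ι₁`-slice `u ↦ Θ(u ⊔ b)` of `Θ ∈ 𝒮(F^ι)` is Schwartz–Bruhat on `F^{ι₁}`** (locally constant by composition; support inside the compact
image of `tsupport Θ` under `v ↦ v|ι₁`). [cite: WeilBNT1967, Chap. VII §2, Def. 1] -/
theorem sliceL_mem_schwartzBruhat {Θ : (ι → F) → ℂ} (hΘ : Θ ∈ SchwartzBruhat (ι → F)) (b : ι₂ → F) :
    (fun u : ι₁ → F => Θ (glue e u b)) ∈ SchwartzBruhat (ι₁ → F) := by
  have hc : Continuous fun u : ι₁ → F => glue e u b := (continuous_glue e).comp (continuous_id.prodMk continuous_const)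
  refine ⟨hΘ.1.comp_continuous hc, ?_⟩
  set K : Set (ι₁ → F) := (fun u : ι₁ → F => glue e u b) ⁻¹' tsupport Θ with hK
  have hKc : IsClosed K := (isClosed_tsupport Θ).preimage hc
  have hKsub : K ⊆ resL e '' tsupport Θ := fun u hu => ⟨glue e u b, hu, resL_glue e u b⟩
  have hKcpt : IsCompact K := (hΘ.2.isCompact.image (continuous_resL (X := F) e)).of_isClosed_subset hKc hKsub
  refine HasCompactSupport.intro' hKcpt hKc fun u hu => ?_
  by_contra h
  exact hu (subset_tsupport _ h)

/-- **the `ι₂`-slice `w ↦ Θ(a ⊔ w)` of `Θ ∈ 𝒮(F^ι)` is Schwartz–Bruhat on `F^{ι₂}`**. [cite: WeilBNT1967, Chap. VII §2, Def. 1] -/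
theorem sliceR_mem_schwartzBruhat {Θ : (ι → F) → ℂ} (hΘ : Θ ∈ SchwartzBruhat (ι → F)) (a : ι₁ → F) :
    (fun w : ι₂ → F => Θ (glue e a w)) ∈ SchwartzBruhat (ι₂ → F) := by
  have hc : Continuous fun w : ι₂ → F => glue e a w := (continuous_glue e).comp (continuous_const.prodMk continuous_id)
  refine ⟨hΘ.1.comp_continuous hc, ?_⟩
  set K : Set (ι₂ → F) := (fun w : ι₂ → F => glue e a w) ⁻¹' tsupport Θ with hK
  have hKc : IsClosed K := (isClosed_tsupport Θ).preimage hc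
  have hKsub : K ⊆ resR e '' tsupport Θ := fun w hw => ⟨glue e a w, hw, resR_glue e a w⟩
  have hKcpt : IsCompact K := (hΘ.2.isCompact.image (continuous_resR (X := F) e)).of_isClosed_subset hKc hKsub
  refine HasCompactSupport.intro' hKcpt hKc fun w hw => ?_
  by_contra h
  exact hw (subset_tsupport _ h)

end Slices

/-! ## §4 Pure-tensor tools — every `Θ ∈ 𝒮(F^ι)` is a finite sum of products `f₁ ⊠ f₂` -/

section PureTensor

variable (F : Type*) [Field F] [ValuativeRel F] [TopologicalSpace F] [IsNonarchimedeanLocalField F]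
  {ι₁ ι₂ ι : Type*} [Fintype ι₁] [Fintype ι₂] [Fintype ι] (e : ι₁ ⊕ ι₂ ≃ ι)

/-- **induction on pure tensors**: a property of Schwartz–Bruhat functions on `F^ι` stable under `0`, `+` and true on every product `f₁ ⊠ f₂` holds
everywhere (exactness of ★ `sumEquivSB`). [cite: WeilBNT1967, Chap. VII §2, Prop. 2] -/
theorem boxSB_induction_on {P : SchwartzBruhat (ι → F) → Prop} (Θ : SchwartzBruhat (ι → F)) (zero : P 0)
    (box : ∀ (f₁ : SchwartzBruhat (ι₁ → F)) (f₂ : SchwartzBruhat (ι₂ → F)), P (boxSB F e f₁ f₂))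
    (add : ∀ Θ₁ Θ₂ : SchwartzBruhat (ι → F), P Θ₁ → P Θ₂ → P (Θ₁ + Θ₂)) : P Θ := by
  obtain ⟨z, rfl⟩ := (sumEquivSB F e).surjective Θ
  induction z using TensorProduct.induction_on with
  | zero => rw [map_zero]; exact zero
  | tmul f₁ f₂ => rw [sumEquivSB_tmul]; exact box f₁ f₂
  | add x y hx hy => rw [map_add]; exact add _ _ hx hy

/-- **every Schwartz–Bruhat function on `F^ι` is a finite sum of products** `Θ = Σ_{(f₁,f₂) ∈ s} f₁ ⊠ f₂`. [cite: WeilBNT1967, Chap. VII §2, Prop. 2] -/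
theorem exists_finset_eq_sum_boxSB (Θ : SchwartzBruhat (ι → F)) :
    ∃ s : Finset (SchwartzBruhat (ι₁ → F) × SchwartzBruhat (ι₂ → F)), Θ = ∑ p ∈ s, boxSB F e p.1 p.2 := by
  obtain ⟨z, rfl⟩ := (sumEquivSB F e).surjective Θ
  obtain ⟨s, hs⟩ := TensorProduct.exists_finset z
  refine ⟨s, ?_⟩
  rw [hs, map_sum]
  exact Finset.sum_congr rfl fun p _ => sumEquivSB_tmul F e p.1 p.2

/-- … read as functions: `Θ(v) = Σ_{(f₁,f₂) ∈ s} f₁(v|ι₁) f₂(v|ι₂)`. [cite: WeilBNT1967, Chap. VII §2, Prop. 2] -/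
theorem exists_finset_coe_eq_sum_mul (Θ : SchwartzBruhat (ι → F)) :
    ∃ s : Finset (SchwartzBruhat (ι₁ → F) × SchwartzBruhat (ι₂ → F)),
      ∀ v : ι → F, (Θ : (ι → F) → ℂ) v = ∑ p ∈ s, (p.1 : (ι₁ → F) → ℂ) (resL e v) * (p.2 : (ι₂ → F) → ℂ) (resR e v) := by
  obtain ⟨s, hs⟩ := exists_finset_eq_sum_boxSB F e Θ
  refine ⟨s, fun v => ?_⟩
  rw [hs, Submodule.coe_sum, Finset.sum_apply]
  exact Finset.sum_congr rfl fun p _ => by rw [coe_boxSB]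

end PureTensor

end Summit.HodgeConjecture.HodgeConjecture.Cruxes.HLiu418.K2LiuLocalPiGlueFubini

end
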